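import Mathlib
import Summits.ValiantsHypothesis.ValiantsHypothesis.Theorems.DivisionGapPerCofactorDegreeReductionStubTwoBaseTowerGcd
import Summits.ValiantsHypothesis.ValiantsHypothesis.Theorems.DivisionGapPerCofactorDegreeReductionStubHiddenRankOneRealDescent

/-!
# Crux `DivisionGap.PerCofactorDegreeReduction` (stmt-ValiantsHypothesis-15046), line `Sketch` —
# stub `stub_twoGateFewnomialCollapse`: a two-gate fewnomial creation of any height collapses to
# one of height at most the degrees of its bases

**Theorem (`stub_twoGateFewnomialCollapse`).** Let `n ≥ 3`, let `u, u' ∈ ℝ≥0[x_ij]` (`n × n`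
variables) be homogeneous and not divisible by `per_n` over `ℝ`, let `c > 0` be real, and suppose
`per_n ∣ u^a + c u'^b` over `ℝ`.  Then `per_n ∣ u^{a'} + c' u'^{b'}` over `ℝ` for some real `c' > 0`
and exponents `1 ≤ a' ≤ deg u'`, `1 ≤ b' ≤ deg u`.

## Proof

Work in `S = ℂ[x]/(per_n)`, a domain and a UFD for `n ≥ 3` (tree theorem
`Summit.ValiantsHypothesis.Theorems.permQuot_isDomain_and_ufm`), graded by total degree
(`Literature.RingTheory.GradedAlgebra.quotGrading`) with degree-`0` part `ℂ`; bars denote classes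
of complexifications.  The hypothesis reads `ū^a + c̄ ū'^b = 0` with `c̄` a unit, and `ū, ū' ≠ 0`
(descent of divisibility from `ℂ` to `ℝ`, `TwoTowerCollapse.per_descent`).
* §1 *Constants.* If the class of a REAL polynomial `p` is a constant `z̄`, then `z = p(0)`:
  `z ∈ ℝ` (imaginary parts, `TwoTowerCollapse.dvd_of_map_dvd_sub_C_mul` with `r' = 1`: otherwise
  `per_n ∣ 1`), and `per_n · H` has no constant term (`constantCoeff_perPoly`).  So constant classes
  of NONNEGATIVE polynomials are nonnegative reals (`eq_coeff_zero_of_perPoly_dvd_sub_C`).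
* §2 *Units.* If `ū^a` were a constant class `z̄` (e.g. `a = 0`, or `ū` a unit — units of the
  graded domain `S` are constants, `HiddenRankOneReal.exists_C_of_isUnit`), then `z ≥ 0` and the
  class of the nonnegative `c u'^b` would be the constant `-z ≤ 0`, forcing `z = 0`, `ū = 0`.
  Symmetrically for `ū'^b`.  Hence `a, b ≥ 1` and `ū, ū'` are non-units.
* §3 *Balance.* `ū^a` and `ū'^b` are associated, so `a · v_q(ū) = b · v_q(ū')` for every
  normalised prime `q` (`normalizedFactors_pow`); with `g = gcd(a, b)`, `a = a₁ g`, `b = b₁ g`,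
  `gcd(a₁, b₁) = 1`: `a₁ v_q(ū) = b₁ v_q(ū')`, so `ū^{a₁}`, `ū'^{b₁}` have the same normalised
  factorisation and are associated (`associated_iff_normalizedFactors_eq_normalizedFactors`):
  `ū^{a₁} = λ̄ ū'^{b₁}` with `λ ∈ ℂˣ` (units are constants), `λ ∈ ℝ` by descent (else
  `per_n ∣ u'^{b₁}`, `per_n` prime, `per_n ∣ u'`).
* §4 *Sign.* Raising to the `g`-th power and comparing with `ū^a = -c̄ ū'^b` in the domain `S`:
  `λ^g + c = 0` (`per_n` divides no nonzero constant, `HiddenRankOneReal.eq_zero_of_perPoly_dvd_C`),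
  so `λ < 0` and `per_n ∣ u^{a₁} + |λ| u'^{b₁}`.
* §5 *Bounds.* `a₁ ∣ b₁ v_q(ū')` and `gcd(a₁, b₁) = 1` give `a₁ ∣ v_q(ū')`; at a normalised prime
  factor `q` of the nonzero non-unit `ū'` (`exists_mem_normalizedFactors`),
  `1 ≤ v_q(ū') ≤ deg u'` (`TwoTowerCollapse.count_normalizedFactors_le`, prime multiplicities of
  homogeneous elements of a graded UFD with `S₀` a field), so `a₁ ≤ deg u'`; symmetrically
  `b₁ ≤ deg u` (`le_of_coprime_balance`).
-/

noncomputable section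

-- `Summit.ValiantsHypothesis.ValiantsHypothesis.…` is the tree's mandated single-conjunct layout
-- (Problem = Summit), so the duplicated namespace component is intended.
set_option linter.dupNamespace false

namespace Summit.ValiantsHypothesis.ValiantsHypothesis.Theorems.DivisionGap.PerCofactorDegreeReduction.TwoGateFewnomialCollapse

open MvPolynomial Literature.Computability.AlgebraicComplexity
open Summit.ValiantsHypothesis.ValiantsHypothesis.Theorems.DivisionGap.PerCofactorDegreeReduction.TwoTowerCollapse
  (per_descent per_ascent dvd_of_map_dvd_sub_C_mul dvd_of_map_ofRealHom_dvd
    count_normalizedFactors_le)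
open Summit.ValiantsHypothesis.ValiantsHypothesis.Theorems.DivisionGap.PerCofactorDegreeReduction.HiddenRankOneReal
  (exists_C_of_isUnit eq_zero_of_perPoly_dvd_C)
open scoped NNReal

/-! ### §5 Graded UFDs: a coprime balance of prime multiplicities bounds the exponent -/

section Graded

open DirectSum SetLike UniqueFactorizationMonoid

/-- **Coprime balance bound.** In an `ℕ`-graded UFD (grading by submodules) whose nonzero
degree-`0` elements are units, let `y ≠ 0` be a homogeneous non-unit of degree `d` and suppose
`a₁ · v_q(x) = b₁ · v_q(y)` for every normalised prime `q`, with `gcd(a₁, b₁) = 1`.  Then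
`a₁ ≤ d`: at a normalised prime factor `q` of `y`, `a₁ ∣ v_q(y)` and `1 ≤ v_q(y) ≤ d`
(`TwoTowerCollapse.count_normalizedFactors_le`, for the same grading re-bundled by additive
subgroups). [folklore] -/
theorem le_of_coprime_balance {R B : Type*} [CommRing R] [CommRing B] [Algebra R B] [IsDomain B]
    [UniqueFactorizationMonoid B] [NormalizationMonoid B] [DecidableEq B]
    (ℬ : ℕ → Submodule R B) [GradedAlgebra ℬ] (h0 : ∀ a ∈ ℬ 0, a ≠ 0 → IsUnit a)
    {x y : B} {a₁ b₁ d : ℕ} (hy : y ∈ ℬ d) (hy0 : y ≠ 0) (hyU : ¬ IsUnit y)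
    (hcop : Nat.Coprime a₁ b₁)
    (h : ∀ q, a₁ * (normalizedFactors x).count q = b₁ * (normalizedFactors y).count q) :
    a₁ ≤ d := by
  -- the same grading, by additive subgroups
  let 𝒜 : ℕ → AddSubgroup B := fun i => (ℬ i).toAddSubgroup
  letI : GradedRing 𝒜 :=
    { one_mem := (SetLike.GradedOne.one_mem : (1 : B) ∈ ℬ 0)
      mul_mem := fun _ _ _ _ ha hb => SetLike.GradedMul.mul_mem (A := ℬ) ha hb
      decompose' := DirectSum.decompose ℬ
      left_inv := (DirectSum.decompose ℬ).left_inv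
      right_inv := (DirectSum.decompose ℬ).right_inv }
  have h0' : ∀ a ∈ 𝒜 0, a ≠ 0 → IsUnit a := fun a ha => h0 a ha
  obtain ⟨q, hq⟩ := exists_mem_normalizedFactors hy0 hyU
  have hq1 : 1 ≤ (normalizedFactors y).count q := Multiset.one_le_count_iff_mem.2 hq
  have hdvd : a₁ ∣ (normalizedFactors y).count q := hcop.dvd_of_dvd_mul_left (Dvd.intro _ (h q))
  calc a₁ ≤ (normalizedFactors y).count q := Nat.le_of_dvd hq1 hdvd
    _ ≤ d := count_normalizedFactors_le 𝒜 h0' (hy : y ∈ 𝒜 d) hy0 q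

end Graded

/-! ### §1 Constant classes of real polynomials modulo the permanent -/

/-- **Constant classes are constant coefficients.** If a REAL polynomial `p` is congruent modulo
`per_n` (over `ℂ`, `n ≥ 1`) to a complex constant `z`, then `z = p(0)`: `z` is real, since
otherwise taking imaginary parts gives `per_n ∣ 1` over `ℝ`
(`TwoTowerCollapse.dvd_of_map_dvd_sub_C_mul`), contradicting the irreducibility of `per_n`; and a
multiple `per_n · H` has no constant term (`constantCoeff_perPoly`). [folklore] -/
theorem eq_coeff_zero_of_perPoly_dvd_sub_C {n : ℕ} (hn : n ≠ 0)
    {p : MvPolynomial (Fin n × Fin n) ℝ} {z : ℂ}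
    (h : perPoly (Fin n) ℂ ∣ MvPolynomial.map Complex.ofRealHom p - C z) :
    z = ((coeff 0 p : ℝ) : ℂ) := by
  haveI : Nonempty (Fin n) := ⟨⟨0, Nat.pos_of_ne_zero hn⟩⟩
  -- `z` is real: otherwise `per_n ∣ 1` over `ℝ`
  have hzim : z.im = 0 := by
    by_contra hzim
    refine (perPoly_irreducible (n := Fin n) (R := ℝ)).not_isUnit (isUnit_of_dvd_one ?_)
    exact dvd_of_map_dvd_sub_C_mul (r := p) hzim (by rwa [map_perPoly, map_one, mul_one])
  have hz : z = ((z.re : ℝ) : ℂ) := Complex.ext (by simp) (by simp [hzim])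
  -- `per_n ∣ p - z` over `ℝ`: compare constant coefficients
  obtain ⟨H, hH⟩ : perPoly (Fin n) ℝ ∣ p - C z.re := by
    refine dvd_of_map_ofRealHom_dvd ?_
    rw [map_perPoly, map_sub, MvPolynomial.map_C, Complex.ofRealHom_eq_coe, ← hz]
    exact h
  have h0 := congr_arg constantCoeff hH
  rw [map_sub, constantCoeff_C, map_mul, constantCoeff_perPoly ℝ (Nat.pos_of_ne_zero hn),
    zero_mul, sub_eq_zero] at h0
  rw [hz, ← h0]
  rfl

/-! ### The theorem -/

/-- **stub_twoGateFewnomialCollapse — A TWO-GATE FEWNOMIAL CREATION OF ANY HEIGHT COLLAPSES TO ONE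
OF HEIGHT AT MOST THE DEGREES OF ITS BASES.**  For `n ≥ 3`, homogeneous `u, u' ∈ ℝ≥0[x_ij]` not
divisible by `per_n` over `ℝ`, a real `c > 0` and `per_n ∣ u^a + c u'^b` over `ℝ`:
`per_n ∣ u^{a'} + c' u'^{b'}` over `ℝ` for some real `c' > 0` and `1 ≤ a' ≤ deg u'`,
`1 ≤ b' ≤ deg u`.  Proof in the graded UFD `S_n = ℂ[x]/(per_n)`
(`Summit.ValiantsHypothesis.Theorems.permQuot_isDomain_and_ufm`): constant classes of nonnegative
polynomials are nonnegative constants (`eq_coeff_zero_of_perPoly_dvd_sub_C`), so neither `ū^a`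
nor `ū'^b` is a constant (the other would be a negative one) — `a, b ≥ 1`, `ū, ū'` non-units;
`ū^a ~ ū'^b` balances the prime multiplicities, `a v_q(ū) = b v_q(ū')`, hence with
`(a₁, b₁) = (a, b)/gcd` the powers `ū^{a₁} ~ ū'^{b₁}` are associated by a unit, a real constant
`λ` (descent), with `λ^{gcd} = -c`, so `λ < 0` and `per_n ∣ u^{a₁} + |λ| u'^{b₁}`; finally
`a₁ ∣ v_q(ū') ≤ deg u'` at a prime factor `q` of `ū'` and symmetrically (`le_of_coprime_balance`).
[abc-tower-collapse, Lever (2); prime-walk-positivizer, c4 valuation lattice `r = 2`] -/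
theorem stub_twoGateFewnomialCollapse (n a b : ℕ) (hn : 3 ≤ n)
    (u u' : MvPolynomial (Fin n × Fin n) ℝ≥0) (c : ℝ≥0) (hc : 0 < c)
    (huh : u.IsHomogeneous u.totalDegree) (hu'h : u'.IsHomogeneous u'.totalDegree)
    (hu : ¬ perPoly (Fin n) ℝ ∣ MvPolynomial.map NNReal.toRealHom u)
    (hu' : ¬ perPoly (Fin n) ℝ ∣ MvPolynomial.map NNReal.toRealHom u')
    (hdvd : perPoly (Fin n) ℝ ∣ MvPolynomial.map NNReal.toRealHom (u ^ a + c • u' ^ b)) :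
    ∃ (a' b' : ℕ) (c' : ℝ≥0), 1 ≤ a' ∧ a' ≤ u'.totalDegree ∧ 1 ≤ b' ∧ b' ≤ u.totalDegree ∧
      0 < c' ∧ perPoly (Fin n) ℝ ∣ MvPolynomial.map NNReal.toRealHom (u ^ a' + c' • u' ^ b') := by
  classical
  -- `S_n = ℂ[x]/(per_n)`: a domain and a UFD, graded by total degree, degree-0 part `ℂ`
  obtain ⟨hdom, hufm⟩ := Summit.ValiantsHypothesis.Theorems.permQuot_isDomain_and_ufm hn
  letI := MvPolynomial.gradedAlgebra (σ := Fin n × Fin n) (R := ℂ)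
  have hhom : (Ideal.span {perPoly (Fin n) ℂ}).IsHomogeneous
      (homogeneousSubmodule (Fin n × Fin n) ℂ) :=
    Ideal.homogeneous_span _ _ fun x hx => by
      rw [Set.mem_singleton_iff] at hx
      subst hx
      exact ⟨_, (mem_homogeneousSubmodule _ _).2 perPoly_isHomogeneous⟩
  letI : GradedAlgebra (Literature.RingTheory.GradedAlgebra.quotGrading
      (homogeneousSubmodule (Fin n × Fin n) ℂ) (Ideal.span {perPoly (Fin n) ℂ})) :=
    Literature.RingTheory.GradedAlgebra.quotGrading.gradedAlgebra
      (homogeneousSubmodule (Fin n × Fin n) ℂ) ⟨Ideal.span {perPoly (Fin n) ℂ}, hhom⟩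
  have h0 : ∀ a ∈ Literature.RingTheory.GradedAlgebra.quotGrading
      (homogeneousSubmodule (Fin n × Fin n) ℂ) (Ideal.span {perPoly (Fin n) ℂ}) 0,
      a ≠ 0 → IsUnit a := by
    intro a ha ha0
    obtain ⟨c, hc, rfl⟩ := Literature.RingTheory.GradedAlgebra.mem_quotGrading_iff.1 ha
    rw [mem_homogeneousSubmodule] at hc
    have hcC : c = C (coeff 0 c) :=
      totalDegree_eq_zero_iff_eq_C.mp ((totalDegree_zero_iff_isHomogeneous _).mpr hc)
    have hr : coeff 0 c ≠ 0 := fun h => ha0 (by rw [hcC, h, C_0, map_zero])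
    rw [hcC]
    exact ((isUnit_iff_ne_zero.mpr hr).map C).map _
  -- the reduction map `Φ : ℝ≥0[x] → ℝ[x] → ℂ[x] → S_n`
  obtain ⟨Φ, hΦdef⟩ : ∃ Φ : MvPolynomial (Fin n × Fin n) ℝ≥0 →+*
      MvPolynomial (Fin n × Fin n) ℂ ⧸ Ideal.span {perPoly (Fin n) ℂ},
      Φ = (Ideal.Quotient.mk (Ideal.span {perPoly (Fin n) ℂ})).comp
        ((MvPolynomial.map Complex.ofRealHom).comp (MvPolynomial.map NNReal.toRealHom)) :=
    ⟨_, rfl⟩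
  have hΦ : ∀ p, Φ p = Ideal.Quotient.mk (Ideal.span {perPoly (Fin n) ℂ})
      (MvPolynomial.map Complex.ofRealHom (MvPolynomial.map NNReal.toRealHom p)) := fun p => by
    rw [hΦdef]; rfl
  have hΦ0 : ∀ p, Φ p = 0 ↔ perPoly (Fin n) ℂ ∣
      MvPolynomial.map Complex.ofRealHom (MvPolynomial.map NNReal.toRealHom p) := fun p => by
    rw [hΦ, Ideal.Quotient.eq_zero_iff_mem, Ideal.mem_span_singleton]
  have hΦC : ∀ (b : ℝ≥0) (p : MvPolynomial (Fin n × Fin n) ℝ≥0),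
      Φ (b • p) = Ideal.Quotient.mk (Ideal.span {perPoly (Fin n) ℂ}) (C ((b : ℝ) : ℂ)) * Φ p := by
    intro b p
    simp only [hΦ, smul_eq_C_mul, map_mul, MvPolynomial.map_C]
    rfl
  -- homogeneous of degree `deg V` stays homogeneous of degree `deg V` in `S_n`
  have hmem : ∀ V : MvPolynomial (Fin n × Fin n) ℝ≥0, V.IsHomogeneous V.totalDegree →
      Φ V ∈ Literature.RingTheory.GradedAlgebra.quotGrading
        (homogeneousSubmodule (Fin n × Fin n) ℂ) (Ideal.span {perPoly (Fin n) ℂ}) V.totalDegree :=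
    fun V hV => by
      rw [hΦ]
      exact Literature.RingTheory.GradedAlgebra.mk_mem_quotGrading
        ((mem_homogeneousSubmodule _ _).2 ((hV.map _).map _))
  -- units of the graded domain `S_n` are constants
  have hunitC : ∀ {x : MvPolynomial (Fin n × Fin n) ℂ ⧸ Ideal.span {perPoly (Fin n) ℂ}},
      IsUnit x → ∃ z : ℂ, x = Ideal.Quotient.mk (Ideal.span {perPoly (Fin n) ℂ}) (C z) :=
    fun hx => exists_C_of_isUnit hx
  -- §1: constant classes of nonnegative polynomials are their (nonnegative) constant coefficients
  have hconst : ∀ (p : MvPolynomial (Fin n × Fin n) ℝ≥0) (z : ℂ),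
      Φ p = Ideal.Quotient.mk (Ideal.span {perPoly (Fin n) ℂ}) (C z) →
      z = (((coeff 0 p : ℝ≥0) : ℝ) : ℂ) := by
    intro p z h
    have h' : perPoly (Fin n) ℂ ∣
        MvPolynomial.map Complex.ofRealHom (MvPolynomial.map NNReal.toRealHom p) - C z := by
      rw [← Ideal.mem_span_singleton, ← Ideal.Quotient.eq_zero_iff_mem, map_sub, ← hΦ, h, sub_self]
    rw [eq_coeff_zero_of_perPoly_dvd_sub_C (by omega) h', coeff_map]
    rfl
  -- the relation `ū^a + c̄ ū'^b = 0` in `S_n`; `ū, ū' ≠ 0`; `c̄` is a unit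
  have hrel : Φ u ^ a +
      Ideal.Quotient.mk (Ideal.span {perPoly (Fin n) ℂ}) (C ((c : ℝ) : ℂ)) * Φ u' ^ b = 0 := by
    have h := (hΦ0 _).2 (per_ascent hdvd)
    rwa [map_add, hΦC, map_pow, map_pow] at h
  have hA : Φ u ≠ 0 := fun h => hu (per_descent ((hΦ0 u).1 h))
  have hB : Φ u' ≠ 0 := fun h => hu' (per_descent ((hΦ0 u').1 h))
  have hcpos : (0 : ℝ) < c := NNReal.coe_pos.2 hc
  have hc0 : ((c : ℝ) : ℂ) ≠ 0 := Complex.ofReal_ne_zero.2 hcpos.ne'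
  have hKU : IsUnit (Ideal.Quotient.mk (Ideal.span {perPoly (Fin n) ℂ}) (C ((c : ℝ) : ℂ))) :=
    ((isUnit_iff_ne_zero.2 hc0).map C).map _
  -- §2: neither `ū^a` nor `ū'^b` is a constant class (the other would be a negative constant)
  have hnotC : ∀ z : ℂ, Φ u ^ a ≠ Ideal.Quotient.mk (Ideal.span {perPoly (Fin n) ℂ}) (C z) := by
    intro z hz
    have h1 := hconst (u ^ a) z (by rw [map_pow, hz])
    have h2 := hconst (c • u' ^ b) (-z) (by
      rw [hΦC, map_pow, map_neg, map_neg, ← hz]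
      linear_combination hrel)
    -- `z ≥ 0` and `-z ≥ 0`, so `z = 0` and `ū^a = 0`
    have h3 : ((coeff 0 (u ^ a) : ℝ≥0) : ℝ) + ((coeff 0 (c • u' ^ b) : ℝ≥0) : ℝ) = 0 := by
      exact_mod_cast (show (((coeff 0 (u ^ a) : ℝ≥0) : ℝ) : ℂ) +
          (((coeff 0 (c • u' ^ b) : ℝ≥0) : ℝ) : ℂ) = 0 by rw [← h1, ← h2, add_neg_cancel])
    have h4 := (add_eq_zero_iff_of_nonneg (coeff 0 (u ^ a)).coe_nonneg
      (coeff 0 (c • u' ^ b)).coe_nonneg).1 h3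
    refine pow_ne_zero a hA ?_
    rw [hz, h1, h4.1, Complex.ofReal_zero, C_0, map_zero]
  have hnotC' : ∀ w : ℂ, Φ u' ^ b ≠ Ideal.Quotient.mk (Ideal.span {perPoly (Fin n) ℂ}) (C w) := by
    intro w hw
    have h1 := hconst (u' ^ b) w (by rw [map_pow, hw])
    have h2 := hconst (u ^ a) (-(((c : ℝ) : ℂ) * w)) (by
      rw [map_pow, map_neg, map_mul, map_neg, map_mul, ← hw]
      linear_combination hrel)
    -- `w ≥ 0` and `-(c w) ≥ 0`, so `w = 0` and `ū'^b = 0`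
    have h3 : (c : ℝ) * ((coeff 0 (u' ^ b) : ℝ≥0) : ℝ) + ((coeff 0 (u ^ a) : ℝ≥0) : ℝ) = 0 := by
      exact_mod_cast (show ((c : ℝ) : ℂ) * (((coeff 0 (u' ^ b) : ℝ≥0) : ℝ) : ℂ) +
          (((coeff 0 (u ^ a) : ℝ≥0) : ℝ) : ℂ) = 0 by rw [← h1, ← h2, add_neg_cancel])
    have h4 := (add_eq_zero_iff_of_nonneg (mul_nonneg c.coe_nonneg (coeff 0 (u' ^ b)).coe_nonneg)
      (coeff 0 (u ^ a)).coe_nonneg).1 h3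
    have h5 : ((coeff 0 (u' ^ b) : ℝ≥0) : ℝ) = 0 :=
      ((mul_eq_zero.1 h4.1).resolve_left hcpos.ne')
    refine pow_ne_zero b hB ?_
    rw [hw, h1, h5, Complex.ofReal_zero, C_0, map_zero]
  -- hence `a, b ≥ 1` and `ū, ū'` are non-units
  have ha1 : 1 ≤ a := by
    rcases Nat.eq_zero_or_pos a with rfl | h
    · exact absurd (by rw [pow_zero, C_1, map_one]) (hnotC 1)
    · exact h
  have hb1 : 1 ≤ b := by
    rcases Nat.eq_zero_or_pos b with rfl | h
    · exact absurd (by rw [pow_zero, C_1, map_one]) (hnotC' 1)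
    · exact h
  have hAU : ¬ IsUnit (Φ u) := fun h => by
    obtain ⟨z, hz⟩ := hunitC h
    exact hnotC (z ^ a) (by rw [hz, map_pow, map_pow])
  have hBU : ¬ IsUnit (Φ u') := fun h => by
    obtain ⟨w, hw⟩ := hunitC h
    exact hnotC' (w ^ b) (by rw [hw, map_pow, map_pow])
  -- §3: balance of prime multiplicities, `a v_q(ū) = b v_q(ū')`
  letI : NormalizationMonoid (MvPolynomial (Fin n × Fin n) ℂ ⧸ Ideal.span {perPoly (Fin n) ℂ}) :=
    (UniqueFactorizationMonoid.strongNormalizationMonoid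
      (α := MvPolynomial (Fin n × Fin n) ℂ ⧸ Ideal.span {perPoly (Fin n) ℂ})).toNormalizationMonoid
  have hassoc : Associated (Φ u ^ a) (Φ u' ^ b) := by
    have h : Φ u ^ a =
        -Ideal.Quotient.mk (Ideal.span {perPoly (Fin n) ℂ}) (C ((c : ℝ) : ℂ)) * Φ u' ^ b := by
      linear_combination hrel
    rw [h]
    exact associated_unit_mul_left _ _ hKU.neg
  have hcount : ∀ q, a * (UniqueFactorizationMonoid.normalizedFactors (Φ u)).count q =
      b * (UniqueFactorizationMonoid.normalizedFactors (Φ u')).count q := fun q => by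
    simpa only [UniqueFactorizationMonoid.normalizedFactors_pow, Multiset.count_nsmul] using
      congr_arg (Multiset.count q) hassoc.normalizedFactors_eq
  -- reduce the exponents by `g = gcd(a, b)`: `a = a₁ g`, `b = b₁ g`, `gcd(a₁, b₁) = 1`
  obtain ⟨g, a₁, b₁, hg, rfl, rfl, hcop⟩ :
      ∃ g a₁ b₁ : ℕ, 0 < g ∧ a = a₁ * g ∧ b = b₁ * g ∧ Nat.Coprime a₁ b₁ :=
    ⟨Nat.gcd a b, a / Nat.gcd a b, b / Nat.gcd a b, Nat.gcd_pos_of_pos_left _ ha1,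
      (Nat.div_mul_cancel (Nat.gcd_dvd_left a b)).symm,
      (Nat.div_mul_cancel (Nat.gcd_dvd_right a b)).symm,
      Nat.coprime_div_gcd_div_gcd (Nat.gcd_pos_of_pos_left _ ha1)⟩
  have ha₁ : 1 ≤ a₁ := Nat.pos_of_ne_zero (left_ne_zero_of_mul (Nat.one_le_iff_ne_zero.1 ha1))
  have hb₁ : 1 ≤ b₁ := Nat.pos_of_ne_zero (left_ne_zero_of_mul (Nat.one_le_iff_ne_zero.1 hb1))
  have hcount' : ∀ q, a₁ * (UniqueFactorizationMonoid.normalizedFactors (Φ u)).count q =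
      b₁ * (UniqueFactorizationMonoid.normalizedFactors (Φ u')).count q := fun q => by
    refine Nat.eq_of_mul_eq_mul_right hg ?_
    rw [mul_right_comm, mul_right_comm b₁]
    exact hcount q
  -- `ū^{a₁}` and `ū'^{b₁}` have the same normalised factorisation: `ū^{a₁} = λ̄ ū'^{b₁}`
  have hassoc' : Associated (Φ u ^ a₁) (Φ u' ^ b₁) := by
    rw [UniqueFactorizationMonoid.associated_iff_normalizedFactors_eq_normalizedFactors
        (pow_ne_zero _ hA) (pow_ne_zero _ hB),
      UniqueFactorizationMonoid.normalizedFactors_pow,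
      UniqueFactorizationMonoid.normalizedFactors_pow, Multiset.ext]
    intro q
    rw [Multiset.count_nsmul, Multiset.count_nsmul]
    exact hcount' q
  obtain ⟨ε, hε⟩ := hassoc'.symm
  obtain ⟨l, hl⟩ := hunitC ε.isUnit
  have hεl : Φ u ^ a₁ = Ideal.Quotient.mk (Ideal.span {perPoly (Fin n) ℂ}) (C l) * Φ u' ^ b₁ := by
    rw [← hε, hl, mul_comm]
  -- `per_n ∣ u^{a₁} - λ u'^{b₁}` over `ℂ`
  have hdiv : perPoly (Fin n) ℂ ∣
      MvPolynomial.map Complex.ofRealHom (MvPolynomial.map NNReal.toRealHom (u ^ a₁)) -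
        C l * MvPolynomial.map Complex.ofRealHom (MvPolynomial.map NNReal.toRealHom (u' ^ b₁)) := by
    rw [← Ideal.mem_span_singleton, ← Ideal.Quotient.eq_zero_iff_mem, map_sub, map_mul, ← hΦ,
      ← hΦ, map_pow, map_pow, hεl, sub_self]
  -- `λ` is real: otherwise `per_n ∣ u'^{b₁}` over `ℝ`, and `per_n` is prime
  have hlim : l.im = 0 := by
    by_contra hlim
    haveI : Nonempty (Fin n) := ⟨⟨0, by omega⟩⟩
    refine hu' ((UniqueFactorizationMonoid.irreducible_iff_prime.mp
      (perPoly_irreducible (n := Fin n) (R := ℝ))).dvd_of_dvd_pow (n := b₁) ?_)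
    rw [← map_pow]
    exact dvd_of_map_dvd_sub_C_mul (r := MvPolynomial.map NNReal.toRealHom (u ^ a₁)) hlim
      (by rwa [map_perPoly])
  have hlre : l = ((l.re : ℝ) : ℂ) := Complex.ext (by simp) (by simp [hlim])
  -- §4: `λ^g + c = 0`, comparing `ū^a = (λ̄ ū'^{b₁})^g` with `ū^a = -c̄ ū'^b` in the domain `S_n`
  have hlg : l ^ g + ((c : ℝ) : ℂ) = 0 := by
    have hpow : Φ u ^ (a₁ * g) =
        Ideal.Quotient.mk (Ideal.span {perPoly (Fin n) ℂ}) (C l) ^ g * Φ u' ^ (b₁ * g) := by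
      rw [pow_mul, hεl, mul_pow, ← pow_mul]
    have h1 : (Ideal.Quotient.mk (Ideal.span {perPoly (Fin n) ℂ}) (C l) ^ g +
        Ideal.Quotient.mk (Ideal.span {perPoly (Fin n) ℂ}) (C ((c : ℝ) : ℂ))) *
          Φ u' ^ (b₁ * g) = 0 := by
      rw [add_mul, ← hpow]
      exact hrel
    have h2 := (mul_eq_zero.1 h1).resolve_right (pow_ne_zero _ hB)
    refine eq_zero_of_perPoly_dvd_C (n := n) (by omega) ?_
    rw [← Ideal.mem_span_singleton, ← Ideal.Quotient.eq_zero_iff_mem, map_add, map_add, map_pow,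
      map_pow]
    exact h2
  -- so `λ` is a negative real; `c' := |λ|`
  have hlneg : l.re < 0 := by
    have h : l.re ^ g + (c : ℝ) = 0 := by
      rw [hlre] at hlg
      exact_mod_cast hlg
    by_contra hnn
    have := pow_nonneg (not_lt.1 hnn) g
    linarith
  obtain ⟨c', hc'0, hc'⟩ : ∃ c' : ℝ≥0, 0 < c' ∧ ((c' : ℝ) : ℂ) = -l :=
    ⟨NNReal.mk (-l.re) (by linarith), NNReal.coe_pos.1 (show (0 : ℝ) < -l.re by linarith), by
      rw [NNReal.coe_mk, Complex.ofReal_neg, ← hlre]⟩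
  -- §5: the bounds `a₁ ≤ deg u'`, `b₁ ≤ deg u`; the collapsed creation `ū^{a₁} + c̄' ū'^{b₁} = 0`
  refine ⟨a₁, b₁, c', ha₁, ?_, hb₁, ?_, hc'0, per_descent ((hΦ0 _).1 ?_)⟩
  · exact le_of_coprime_balance _ h0 (hmem u' hu'h) hB hBU hcop hcount'
  · exact le_of_coprime_balance _ h0 (hmem u huh) hA hAU hcop.symm fun q => (hcount' q).symm
  · rw [map_add, hΦC, hc', map_pow, map_pow, hεl, ← add_mul, ← map_add, ← map_add, add_neg_cancel,
      map_zero, map_zero, zero_mul]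

end Summit.ValiantsHypothesis.ValiantsHypothesis.Theorems.DivisionGap.PerCofactorDegreeReduction.TwoGateFewnomialCollapse

end
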